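import Literature.NumberTheory.PAdicHodge.TateSenCocycles
import Literature.NumberTheory.PAdicHodge.BaseGaloisAction
import HarnessLib

/-!
# The Tate–Sen condition (TS1) for `ℂ_F` — Tate's almost étale lemma — as ONE named fact, and
# `H¹_cont(H₀, ℂ_F) = 0` for `H₀ = Gal(F̄/ℚ_p(μ_{p^∞}))` by name

Topic `Literature/NumberTheory/PAdicHodge`; sequel to `TateSenCocycles` (the sorry-free engine: every continuous
`1`-cocycle of a compact group satisfying (TS1), acting isometrically on `ℂ_F`, is a coboundary —
`TateSen.exists_eq_smul_sub_of_TS1`, instances `TateSen.baseKer_exists_eq_smul_sub_of_TS1` for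
`H₀ = ker χ ≤ G₀ = Gal(F̄/K₀)` and `TateSen.kerCyclotomic_exists_eq_smul_sub_of_TS1` for `H_F = ker χ_F ≤ Γ_F`,
each with (TS1) DISPLAYED as a hypothesis). This file names that hypothesis as what it is in print — ONE
cite-only named fact (closed `def … : Prop`, D-0014), no `_holds` (size L–XL: the different of the cyclotomic
tower, Tate 1967 §3.1 Prop. 5, §3.2 Prop. 6 and Prop. 9; not in the tree) — and records the by-name corollary
at the base of Tate's tower, the form consumed by the `G₀`-level assembly of Tate's `H¹` theorems (tree
`TateTrace` / `TateDescent` / `TateTwistCoboundary`, seats bsd-line-edix-p1/p2 of cell `pub/bsd-wall`).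

## The printed statements

* L. Berger, P. Colmez, *Familles de représentations de de Rham et monodromie p-adique*, Astérisque 319
  (2008) (held: `paper:w3084680959`). Setting (§3.1): `G₀` a profinite group, `χ : G₀ → ℤ_pˣ` continuous with
  open image, `H₀ = ker χ`, `Λ̃` a `ℤ_p`-algebra complete for `val_Λ` on which `G₀` acts continuously and
  isometrically. Déf. 3.1.3 [p. 9]: « Les conditions de Tate-Sen sont les trois conditions suivantes :
  (TS1) Il existe `c₁ > 0` tel que, quels que soient les sous-groupes ouverts `H₁ ⊂ H₂` de `H₀`, il existe
  `α ∈ Λ̃^{H₁}` vérifiant `val_Λ(α) > −c₁` et `Σ_{τ ∈ H₂/H₁} τ(α) = 1`. (TS2) … (TS3) … ».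
  Prop. 4.1.1 [p. 14] (for `K` a finite extension of `ℚ_p`, `K_n = K(μ_{pⁿ})`, `H_K = Gal(K̄/K_∞)`, `G₀ = G_K`):
  « L'anneau `Λ̃ = ℂ_p` vérifie les conditions (TS1), (TS2) et (TS3), avec `Λ̃^{H_L} = L̂_∞`, `Λ_{H_L,n} = L_n`,
  `R_{H_L,n} = R_{L,n}` et `val_Λ = val_p`, les constantes `c₁ > 0`, `c₂ > 0` et `c₃ > 1/(p−1)` pouvant être
  choisies arbitrairement »; « Cet exemple est dû à Tate (cf. [Tat66]) ». In the proof of Lemme 3.2.1 the sum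
  `Σ_{τ ∈ H/H₁}` is taken over an arbitrary system `Q` of representatives of `H/H₁` (well defined on `Λ̃^{H₁}`).
* J. Tate, *p-divisible groups* (1967), §3.2, Prop. 9 (`Tr_{L/K_∞}(𝔬_L) ⊇ 𝔪_∞` for every finite extension
  `L` of `K_∞ = K(μ_{p^∞})`) — the source of Prop. 4.1.1; Prop. 10 (`H¹_cont(H, C) = 0`) its consequence.

## What the fact says (tree vocabulary) and what is a reading

`tate1967_TS1_completedAlgClosure`: for a non-archimedean local field `F` of characteristic `0` and residue
characteristic `p` (`hp : valuation F p < 1`), with `G₀ = Gal(F̄/K₀)` the Galois group over the base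
`K₀ = PadicBase F p hp ≅ ℚ_p` (tree `BaseGaloisGroup hp`, Krull topology), `χ` its cyclotomic character
(`BaseGaloisGroup.baseCyclotomicCharacter hp`), `H₀ = ker χ = Gal(F̄/K₀(μ_{p^∞}))` with the induced topology,
acting on `ℂ_F = CompletedAlgClosure F` (tree `CompletedAlgClosure.instBaseAction`, isometric): THERE IS a real
`K` such that for all open subgroups `H₁ ≤ H₂` of `H₀` and EVERY finite system `S ⊆ H₂` of representatives of the
left cosets `H₂/H₁` (each `h ∈ H₂` has exactly one `s ∈ S` with `s⁻¹h ∈ H₁`) there is `α ∈ ℂ_F` fixed by `H₁`,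
with `‖α‖ ≤ K` and `Σ_{s ∈ S} s • α = 1`. This is (TS1) of Déf. 3.1.3 for `Λ̃ = ℂ_p = ℂ_F` and `K = K₀ = ℚ_p`
(Prop. 4.1.1), with: the valuation bound `val(α) > −c₁` rendered as a norm bound `‖α‖ ≤ K` (equivalent up to
the normalisation of `‖·‖`, both constants existential), and `∃ α` placed after `∀ S` (weaker than print,
where one `α` serves every system of representatives). READING (own attribution, ≤ 3 lines): `ℂ_F` — the
completion of the algebraic closure `F̄` of the finite extension `F/ℚ_p`, which is also an algebraic closure of
`K₀ ≅ ℚ_p` — is Berger–Colmez's `ℂ_p` with its `G_{ℚ_p}`-action; `Gal(F̄/K₀(μ_{p^∞})) = ker χ`.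
-- TODO(general form): (TS2)–(TS3) (Tate's normalised traces `R_{H,n}`; cf. the tree's `TateNormalizedTrace`,
-- which treats `H = H₀` over `K₀(μ_{p^∞})`), and (TS1) for a general finite `K/ℚ_p` as base (`H_K ≤ G_K`).

## Consequences recorded here

`baseKer_exists_eq_smul_sub` — **`H¹_cont(H₀, ℂ_F) = 0`** (Tate 1967 §3.2 Prop. 10; Berger–Colmez Cor. 3.2.2,
additive case `d = 1`, `H = H₀`) GRANTED the named fact: the system of representatives `q ↦ q.out` of `H₀/U`
turns the fact into the displayed hypothesis of `TateSen.baseKer_exists_eq_smul_sub_of_TS1`;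
`kerCyclotomic_exists_eq_smul_sub` — **`H¹_cont(H_F, ℂ_F) = 0`** over `F` itself (`H_F = ker χ_F ≤ Γ_F`, tree
`Sen.kerCyclotomic F p`) GRANTED the same fact, by `TateSen.kerCyclotomic_exists_eq_smul_sub_of_baseTS1`.
No instance, no notation, no `sorry`; nothing else is asserted; BSD is not proved by any of this.
-/

noncomputable section

open Field ValuativeRel
open Literature.NumberTheory.GaloisRepresentations
open Literature.NumberTheory.GaloisRepresentations.IsNonarchimedeanLocalField

namespace Literature.NumberTheory.PAdicHodge

/-- **Tate 1967 §3.2 Prop. 9 in Berger–Colmez's form: the Tate–Sen condition (TS1) for `Λ̃ = ℂ_p`**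
(Berger–Colmez 2008, Déf. 3.1.3 (TS1) with Prop. 4.1.1 « L'anneau `Λ̃ = ℂ_p` vérifie (TS1) »). For a
non-archimedean local field `F` of characteristic `0` and residue characteristic `p`, `G₀ = Gal(F̄/K₀)` over the
base `K₀ = PadicBase F p hp ≅ ℚ_p`, `H₀ = ker χ = Gal(F̄/K₀(μ_{p^∞}))` (induced topology) acting on `ℂ_F`: there is
a constant `K` such that for all open subgroups `H₁ ≤ H₂` of `H₀` and every finite system `S ⊆ H₂` of
representatives of `H₂/H₁` there is `α ∈ ℂ_F` fixed by `H₁` with `‖α‖ ≤ K` and `Σ_{s ∈ S} s • α = 1`. Printed: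
« Il existe `c₁ > 0` tel que, quels que soient les sous-groupes ouverts `H₁ ⊂ H₂` de `H₀`, il existe
`α ∈ Λ̃^{H₁}` vérifiant `val_Λ(α) > −c₁` et `Σ_{τ∈H₂/H₁} τ(α) = 1` »; weaker than print (norm bound for the
valuation bound; `∃ α` after `∀ S`). Named fact, no `_holds`.
[cite: Tate1967, §3.2 Prop. 9] [cite: BergerColmez2008, Déf. 3.1.3 (TS1) and Prop. 4.1.1] -/
def tate1967_TS1_completedAlgClosure : Prop :=
  ∀ {F : Type} [Field F] [ValuativeRel F] [TopologicalSpace F] [IsNonarchimedeanLocalField F] [CharZero F]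
    {p : ℕ} [Fact p.Prime] (hp : valuation F p < 1),
    ∃ K : ℝ, ∀ (H₁ H₂ : OpenSubgroup (BaseGaloisGroup.baseCyclotomicCharacter hp).ker), H₁ ≤ H₂ →
      ∀ S : Finset (BaseGaloisGroup.baseCyclotomicCharacter hp).ker,
        (∀ s ∈ S, s ∈ H₂) → (∀ h ∈ H₂, ∃! s, s ∈ S ∧ s⁻¹ * h ∈ H₁) →
        ∃ α : CompletedAlgClosure F, (∀ u ∈ H₁, u • α = α) ∧ ‖α‖ ≤ K ∧ ∑ s ∈ S, s • α = 1

-- TODO(general form): (TS2), (TS3); (TS1) over a general finite base `K/ℚ_p` (`H_K ≤ G_K`).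

/-- **`H¹_cont(H₀, ℂ_F) = 0`** for `H₀ = ker χ = Gal(F̄/K₀(μ_{p^∞})) ≤ G₀ = Gal(F̄/K₀)`, `K₀ ≅ ℚ_p` the base of
Tate's tower (Tate 1967 §3.2 Prop. 10; Berger–Colmez 2008 Cor. 3.2.2, additive case `d = 1`): every continuous
crossed homomorphism `c : H₀ → ℂ_F` is a coboundary `c(g) = g b − b` — GRANTED the named fact
`tate1967_TS1_completedAlgClosure` (displayed), by the tree theorem `TateSen.baseKer_exists_eq_smul_sub_of_TS1`
applied to the system of representatives `q ↦ q.out` of `H₀/U`. CONDITIONAL on that fact.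
[cite: Tate1967, §3.2 Prop. 10] [cite: BergerColmez2008, Cor. 3.2.2] -/
theorem baseKer_exists_eq_smul_sub (hTS1 : tate1967_TS1_completedAlgClosure)
    {F : Type} [Field F] [ValuativeRel F] [TopologicalSpace F] [IsNonarchimedeanLocalField F] [CharZero F]
    {p : ℕ} [Fact p.Prime] (hp : valuation F p < 1)
    (c : (BaseGaloisGroup.baseCyclotomicCharacter hp).ker → CompletedAlgClosure F)
    (hc : ∀ g h : (BaseGaloisGroup.baseCyclotomicCharacter hp).ker, c (g * h) = c g + g • c h)
    (hcont : Continuous c) :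
    ∃ b : CompletedAlgClosure F, ∀ g : (BaseGaloisGroup.baseCyclotomicCharacter hp).ker, c g = g • b - b := by
  classical
  -- `H₀` is compact (closed in the compact `G₀`), so `H₀/U` is finite for `U` open
  haveI : IsGalois (PadicBase F p hp) (NormedAlgClosure F) := inferInstance
  have hcl : IsClosed (((BaseGaloisGroup.baseCyclotomicCharacter hp).ker :
      Subgroup (BaseGaloisGroup hp)) : Set (BaseGaloisGroup hp)) := by
    have h : (((BaseGaloisGroup.baseCyclotomicCharacter hp).ker : Subgroup (BaseGaloisGroup hp)) :
        Set (BaseGaloisGroup hp)) = (BaseGaloisGroup.baseCyclotomicCharacter hp) ⁻¹' {1} := by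
      ext g
      exact MonoidHom.mem_ker
    rw [h]
    exact isClosed_singleton.preimage
      (cyclotomicCharacter.continuous p (PadicBase F p hp) (NormedAlgClosure F))
  haveI : CompactSpace (BaseGaloisGroup.baseCyclotomicCharacter hp).ker :=
    isCompact_iff_compactSpace.mp hcl.isCompact
  refine TateSen.baseKer_exists_eq_smul_sub_of_TS1 hp ?_ c hc hcont
  obtain ⟨K, hK⟩ := hTS1 hp
  refine ⟨K, fun U => ?_⟩
  haveI : Fintype ((BaseGaloisGroup.baseCyclotomicCharacter hp).ker ⧸ U.toSubgroup) := Fintype.ofFinite _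
  -- the system of representatives `q ↦ q.out`
  set S : Finset (BaseGaloisGroup.baseCyclotomicCharacter hp).ker :=
    Finset.univ.image (fun q : (BaseGaloisGroup.baseCyclotomicCharacter hp).ker ⧸ U.toSubgroup => q.out)
    with hS
  have hrep : ∀ h ∈ (⊤ : OpenSubgroup (BaseGaloisGroup.baseCyclotomicCharacter hp).ker),
      ∃! s, s ∈ S ∧ s⁻¹ * h ∈ U := by
    intro h _
    refine ⟨(QuotientGroup.mk h : _ ⧸ U.toSubgroup).out, ⟨?_, ?_⟩, ?_⟩
    · exact Finset.mem_image.mpr ⟨QuotientGroup.mk h, Finset.mem_univ _, rfl⟩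
    · exact QuotientGroup.eq.mp (QuotientGroup.out_eq' (QuotientGroup.mk h : _ ⧸ U.toSubgroup))
    · rintro s ⟨hs, hsU⟩
      obtain ⟨q, -, rfl⟩ := Finset.mem_image.mp hs
      have hq : (QuotientGroup.mk q.out : _ ⧸ U.toSubgroup) = QuotientGroup.mk h := QuotientGroup.eq.mpr hsU
      rw [QuotientGroup.out_eq'] at hq
      rw [hq]
  obtain ⟨α, hαU, hαK, hαS⟩ := hK U ⊤ le_top S (fun s _ => trivial) hrep
  refine ⟨α, hαU, hαK, ?_⟩
  rw [finsum_eq_sum_of_fintype, ← hαS, hS, Finset.sum_image]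
  intro q₁ _ q₂ _ h
  exact Quotient.out_injective h

/-- **`H¹_cont(H_F, ℂ_F) = 0` over `F`** (Tate 1967 §3.2 Prop. 10 for the `p`-adic field `F`; Berger–Colmez 2008
Cor. 3.2.2, additive case): for a non-archimedean local field `F` of characteristic `0` and residue characteristic
`p`, every continuous crossed homomorphism `c : H_F → ℂ_F` of `H_F = ker χ_F = Gal(F̄/F(μ_{p^∞}))` (tree
`Sen.kerCyclotomic F p`, profinite topology) is a coboundary `c(g) = g b − b` — GRANTED the named fact
`tate1967_TS1_completedAlgClosure` (displayed), by the tree theorem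
`TateSen.kerCyclotomic_exists_eq_smul_sub_of_baseTS1` (transport of (TS1) along `Γ_F ↪ G₀`). CONDITIONAL on that
fact; this is brick (b2) of the `H¹` half of Tate's theorems feeding Kato, LNM 1553, II Prop. 1.2.3
(`hasDualExp_of_isDeRham`). [cite: Tate1967, §3.2 Prop. 10] [cite: BergerColmez2008, Cor. 3.2.2] -/
theorem kerCyclotomic_exists_eq_smul_sub (hTS1 : tate1967_TS1_completedAlgClosure)
    {F : Type} [Field F] [ValuativeRel F] [TopologicalSpace F] [IsNonarchimedeanLocalField F] [CharZero F]
    (p : ℕ) [Fact p.Prime] (hp : valuation F p < 1)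
    (c : Sen.kerCyclotomic F p → CompletedAlgClosure F)
    (hc : ∀ g h : Sen.kerCyclotomic F p, c (g * h) = c g + g • c h) (hcont : Continuous c) :
    ∃ b : CompletedAlgClosure F, ∀ g : Sen.kerCyclotomic F p, c g = g • b - b :=
  TateSen.kerCyclotomic_exists_eq_smul_sub_of_baseTS1 p hp (hTS1 hp) c hc hcont

end Literature.NumberTheory.PAdicHodge

end
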